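import Literature.AnabelianGeometry.EtaleTheta.ThetaCoversAxOfSection
import HarnessLib

/-!
# [EtTh] §2 Def. 2.1 / 2.3 at a `MuTwoSetting` C-level record for the SECTION cover datum: `Π_X̲` of type
# `(1, l-tors)`, `Π_C̲ := Π_X̲·⟨c⟩` of type `(1, l-tors)±`, and an open `Π_C̲̲` of type `(1, l-torsΘ)±` (proof-only)

S. Mochizuki, *The étale theta function and its Frobenioid-theoretic manifestations*, Publ. RIMS **45** (2009) [EtTh], §2:
Def. 2.1 p. 36 («`Π̄^ell_X ↠ Q` … the restricted map `D_x → Q` is trivial»), Prop. 2.2 (ii)/(iii) p. 37, Def. 2.3 p. 38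
[cite: MochizukiEtTh2009, Def 2.1 p.36]. Cell abc-iut, layer L2, seat abc-iut-L2-t10 (gen 6) — `coverDataAx` constructor
lineage, row «COVERDATAAX FROM A SECTION» part 2 (R312 junction: the hIx-free route to a `TemperedCoverData` / `OrbitEmbedding`
at the KUMMER-carrying models). PROOF-ONLY (0 defs, no instance, no new `Prop`).

abc-iut-L2-d3's Def. 2.1 / 2.3 chain (`Sec2Def21OfSetting`, `ThetaCoversTemperedOfSetting`: `isTypeLTors_ofSetting`,
`isTypeLTorsPm_ofSetting`, `isInversion_ofSetting`, `exists_PiCuu_ofSetting'`) is stated over gen 4's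
`(e.piCDataOf ιC hιC).coverDataAx … hx hIx …` — the GEOMETRIC cusp datum, binder hIx. THIS file re-keys the four on gen 6's
`PiCData.coverDataAxOfSection … s hsa …` (`ThetaCoversAxOfSection`, p449075 ✓: `Dx := barTheta ⊔ incl(toHat(s G_K))`, NO hIx,
NO cusp), for a section `s` valued in `Π^tp_Y = Ker toZ` (`hsZ`); every field but `IsTypeLTors.Dx_le` is abc-iut-L2-d3's lemma
BY NAME (their statements are about `e.piCDataOf ιC hιC`, not about the cover record), and `Dx_le` is gen 6's
`sectionDx_le_closureXu`:
* `isTypeLTors_ofSection` (Def. 2.1 `X̲`), `isTypeLTorsPm_ofSection` (Def. 2.1 `C̲`, `c² ∈ Π_X̲` from hιell),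
  `isInversion_ofSection`;
* **`exists_PiCuu_ofSection'`** (Def. 2.3): an OPEN `P ⊇ S` of type `(1, l-torsΘ)±` with `(P ∩ Π_X)·Δ̄_Θ-preimage = Π_X̲`,
  for the CLOSED splitting `S := incl(toHat(s G_K))·Ker` of the section itself (`isSplitting_sectionSplitting`,
  `isClosed_splittingOfSection`) — binders = {op, hιell, hN (L02), s continuous into `Π^tp_Y`} ONLY.
The assembly `temperedCoverDataOfSection` (class (b)) is the next file. HONEST FRAMING: statements about the cell's typed
interface and its models; nothing asserts a `MuTwoSetting` exists for a curve; [EtTh] is refereed; no side is taken on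
[IUTchIII] Cor. 3.12; typed ≠ proved elsewhere.
-/

noncomputable section

namespace Literature.AnabelianGeometry.EtaleTheta

open Literature.AnabelianGeometry.SemiGraphs ThetaCovers
open _root_.Topology

namespace MuTwoSetting.CLevelData

variable {p : ℕ} [Fact p.Prime] {M : MuTwoSetting p}
variable {PC : Type} [Group PC] [TopologicalSpace PC] [IsTopologicalGroup PC] [T2Space PC]

section Binders

variable (e : M.CLevelData) (ιC : M.GtpC →ₜ* PC) (hιC : IsProfiniteCompletion ιC)
  (op : M.toThetaSetting.OncePuncturedData) {l : ℕ} (hodd : Odd l)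
  (s : ↥M.GK →* M.PiTemp) (hsa : ∀ σ, M.aug (s σ) = (σ : GQp p))
  (hιell : ∀ c ∈ (e.piCDataOf ιC hιC).augGK.ker, c ∉ (e.piCDataOf ιC hιC).PiX →
    ∀ d ∈ (e.piCDataOf ιC hιC).PiX ⊓ (e.piCDataOf ιC hιC).augGK.ker,
      c * d * c⁻¹ * d ∈ (e.piCDataOf ιC hιC).barTheta l)

/-- **Def. 2.1 for the section cover: `Π_X̲ := cl(ιC(inclX(Π^tp_X̲)))` is of type `(1, l-tors)`** — the clause «`D_x → Q` is
trivial» now for the `D̄_x`-preimage of a section into `Π^tp_Y` (`sectionDx_le_closureXu`); the other four clauses are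
abc-iut-L2-d3's. [cite: MochizukiEtTh2009, Def 2.1 p.36] -/
theorem isTypeLTors_ofSection (hsZ : ∀ σ, M.toZ (s σ) = 1) :
    ((e.piCDataOf ιC hιC).coverDataAxOfSection l op hodd s hsa hιell
        ((e.piCDataOf ιC hιC).inv_theta_of_inv_ell l op hιell)).toCoverData.IsTypeLTors
      (((M.GtpXu l).map M.inclX).map ιC.toMonoidHom).topologicalClosure := by
  haveI : NeZero l := ⟨by obtain ⟨k, hk⟩ := hodd; omega⟩
  exact
    { le := e.closureXu_le_PiX ιC hιC l
      quot := e.exists_quot_closureXu ιC hιC l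
      barTheta_le := e.barTheta_le_closureXu ιC hιC op l
      delta_sup := e.closureXu_sup_deltaX ιC hιC l
      Dx_le := e.sectionDx_le_closureXu ιC hιC op l s hsZ }

/-- **Def. 2.1 for the section cover: `Π_C̲ := Π_X̲·⟨c⟩` is of type `(1, l-tors)±`** for any `c ∈ Δ_C ∖ Π_X` (`c² ∈ Π_X̲` from
hιell, abc-iut-L2-d3's `sq_mem_closureXu_of_inv_ell`; `hN` = tempered normality of `Π^tp_X̲`, L02).
[cite: MochizukiEtTh2009, Def 2.1 p.36] -/
theorem isTypeLTorsPm_ofSection (hsZ : ∀ σ, M.toZ (s σ) = 1) (hN : ((M.GtpXu l).map M.inclX).Normal)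
    {c : PC} (hc : c ∈ (e.piCDataOf ιC hιC).augGK.ker) (hcX : c ∉ (e.piCDataOf ιC hιC).PiX) :
    ((e.piCDataOf ιC hιC).coverDataAxOfSection l op hodd s hsa hιell
        ((e.piCDataOf ιC hιC).inv_theta_of_inv_ell l op hιell)).toCoverData.IsTypeLTorsPm
      ((((M.GtpXu l).map M.inclX).map ιC.toMonoidHom).topologicalClosure ⊔ Subgroup.zpowers c) :=
  CoverDataAx.isTypeLTorsPm_sup_zpowers (hHn := closureXu_normal ιC hιC l hN) _
    (e.isTypeLTors_ofSection ιC hιC op hodd s hsa hιell hsZ)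
    (e.sq_mem_closureXu_of_inv_ell ιC hιC op hodd hιell hc hcX) hcX

/-- **`c ∈ Δ_C ∖ Π_X` is an inversion of `Π_C̲ := Π_X̲·⟨c⟩`** for the section cover. [cite: MochizukiEtTh2009, Def 2.1 p.36] -/
theorem isInversion_ofSection {c : PC} (hc : c ∈ (e.piCDataOf ιC hιC).augGK.ker)
    (hcX : c ∉ (e.piCDataOf ιC hιC).PiX) :
    ((e.piCDataOf ιC hιC).coverDataAxOfSection l op hodd s hsa hιell
        ((e.piCDataOf ιC hιC).inv_theta_of_inv_ell l op hιell)).toCoverData.IsInversion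
      ((((M.GtpXu l).map M.inclX).map ιC.toMonoidHom).topologicalClosure ⊔ Subgroup.zpowers c) c :=
  { mem := Subgroup.mem_sup_right (Subgroup.mem_zpowers c)
    mem_delta := hc
    not_mem := hcX }

/-- **Def. 2.3 for the section cover — `Π_C̲̲` EXISTS, IS OPEN, contains the section's splitting, and is PINNED to `X̲`**:
some `P = S·E·⟨ι₀⟩ ⊇ S := incl(toHat(s G_K))·Ker` is of type `(1, l-torsΘ)±`, open in `P_C`, with
`(P ∩ Π_X)·Δ̄_Θ-preimage = Π_X̲` (abc-iut-L2-d3's `exists_PiCuu_ofSetting'` re-keyed: the splitting is the SECTION's own —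
`isSplitting_sectionSplitting`, closed for continuous `s` — so NO cusp / hIx / external `(S, hS, hSc)` binder remains).
[cite: MochizukiEtTh2009, Def 2.3 p.38] -/
theorem exists_PiCuu_ofSection' (hsZ : ∀ σ, M.toZ (s σ) = 1) (hN : ((M.GtpXu l).map M.inclX).Normal)
    (hsc : Continuous s) :
    ∃ P : Subgroup PC,
      ((e.piCDataOf ιC hιC).coverDataAxOfSection l op hodd s hsa hιell
          ((e.piCDataOf ιC hιC).inv_theta_of_inv_ell l op hιell)).toCoverData.IsTypeLTorsThetaPm P ∧
        IsOpen (P : Set PC) ∧ (e.piCDataOf ιC hιC).sectionRange s ⊔ (e.piCDataOf ιC hιC).barKer l ≤ P ∧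
        (P ⊓ (e.piCDataOf ιC hιC).PiX) ⊔ (e.piCDataOf ιC hιC).barTheta l =
          (((M.GtpXu l).map M.inclX).map ιC.toMonoidHom).topologicalClosure := by
  set X := (e.piCDataOf ιC hιC).coverDataAxOfSection l op hodd s hsa hιell
    ((e.piCDataOf ιC hιC).inv_theta_of_inv_ell l op hιell) with hXdef
  haveI : CompactSpace X.PiC := hιC.compactSpace
  have hS : X.toCoverData.IsSplitting ((e.piCDataOf ιC hιC).sectionRange s ⊔ (e.piCDataOf ιC hιC).barKer l) :=
    (e.piCDataOf ιC hιC).isSplitting_sectionSplitting l op hodd s hsa hιell _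
  have hSc : IsClosed (((e.piCDataOf ιC hιC).sectionRange s ⊔ (e.piCDataOf ιC hιC).barKer l : Subgroup PC) :
      Set PC) :=
    (e.piCDataOf ιC hιC).isClosed_splittingOfSection l op s hsc
  obtain ⟨c, hc, hcX⟩ := exists_mem_ker_augGK_not_mem_PiX (e.piCDataOf ιC hιC)
  have hT := e.isTypeLTors_ofSection ιC hιC op hodd s hsa hιell hsZ
  have hH' := e.isTypeLTorsPm_ofSection ιC hιC op hodd s hsa hιell hsZ hN hc hcX
  have hι := e.isInversion_ofSection ιC hιC op hodd s hsa hιell hc hcX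
  haveI := closureXu_normal ιC hιC l hN
  have hHu : ((((M.GtpXu l).map M.inclX).map ιC.toMonoidHom).topologicalClosure ⊔ Subgroup.zpowers c) ⊓
      (e.piCDataOf ιC hιC).PiX = (((M.GtpXu l).map M.inclX).map ιC.toMonoidHom).topologicalClosure :=
    sup_zpowers_inf_eq_of_sq_mem hT.le (e.sq_mem_closureXu_of_inv_ell ιC hιC op hodd hιell hc hcX) hcX
  obtain ⟨E, ι₀, hι₀, -, hE, hP⟩ := X.exists_isTypeLTorsThetaPm hH' hι hS
  refine ⟨(((e.piCDataOf ιC hιC).sectionRange s ⊔ (e.piCDataOf ιC hιC).barKer l) ⊔ E) ⊔ Subgroup.zpowers ι₀, hP,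
    X.isOpen_splitting_sup_eigen_sup_zpowers hH' hE hS hSc ι₀, le_sup_left.trans le_sup_left, ?_⟩
  have hSE := X.splitting_sup_eigen_sup_barTheta hH' hE hS
  have hle : (((e.piCDataOf ιC hιC).sectionRange s ⊔ (e.piCDataOf ιC hιC).barKer l) ⊔ E) ⊔ Subgroup.zpowers ι₀ ≤
      (((M.GtpXu l).map M.inclX).map ιC.toMonoidHom).topologicalClosure ⊔ Subgroup.zpowers c :=
    sup_le ((X.splitting_sup_eigen_le hH' hE hS).trans inf_le_left)
      ((Subgroup.zpowers_le (G := X.PiC)).2 hι₀.mem)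
  refine le_antisymm ?_ ?_
  · -- `(P ∩ Π_X)·barTheta ≤ (H' ∩ Π_X)·barTheta = Π_X̲`
    rw [← hHu]
    exact sup_le (inf_le_inf_right _ hle) (hHu.symm ▸ hT.barTheta_le)
  · -- `Π_X̲ = H' ∩ Π_X = S·E·barTheta ≤ (P ∩ Π_X)·barTheta`
    have hSE' : ((((M.GtpXu l).map M.inclX).map ιC.toMonoidHom).topologicalClosure ⊔ Subgroup.zpowers c) ⊓
        (e.piCDataOf ιC hιC).PiX ≤
        (((e.piCDataOf ιC hιC).sectionRange s ⊔ (e.piCDataOf ιC hιC).barKer l) ⊔ E) ⊔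
          (e.piCDataOf ιC hιC).barTheta l := hSE.ge
    have hPE : ((e.piCDataOf ιC hιC).sectionRange s ⊔ (e.piCDataOf ιC hιC).barKer l) ⊔ E ≤
        ((((e.piCDataOf ιC hιC).sectionRange s ⊔ (e.piCDataOf ιC hιC).barKer l) ⊔ E) ⊔ Subgroup.zpowers ι₀) ⊓
          (e.piCDataOf ιC hιC).PiX :=
      le_inf le_sup_left ((X.splitting_sup_eigen_le hH' hE hS).trans inf_le_right)
    rw [← hHu]
    exact hSE'.trans (sup_le_sup_right hPE _)

end Binders

end MuTwoSetting.CLevelData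

end Literature.AnabelianGeometry.EtaleTheta

end
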